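import Mathlib

set_option linter.dupNamespace false

/-!
# `RegularTowerGap` — stub `stub_fekete` (line Sketch, crux stmt-MatrixMultiplication-7358)

Fekete's lemma in the weak form the crux needs: a nonnegative submultiplicative sequence
`Z : ℕ → ℝ` with `Z k₀ < P ^ k₀` at ONE scale `k₀ ≥ 1` satisfies `Z k ≤ P ^ k` for all large `k`.

Proof: iterating submultiplicativity gives `Z (q k₀ + r) ≤ (Z k₀)^q Z r`; writing
`ρ = Z k₀ / P^k₀ ∈ [0, 1)` and bounding the finitely many ratios `Z r / P^r`, `r < k₀`, by their
sum `B`, one gets `Z k ≤ ρ^q B P^k` with `q = k / k₀ → ∞`, and `ρ^q B ≤ 1` eventually.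
-/

namespace Summit.MatrixMultiplication.MatrixMultiplication.Theorems.RegularTowerGap

/-- Iterated submultiplicativity: `Z (q k₀ + r) ≤ (Z k₀)^q · Z r` for a nonnegative
submultiplicative sequence. -/
theorem fekete_submul_iter (Z : ℕ → ℝ) (hZ0 : ∀ k, 0 ≤ Z k)
    (hsub : ∀ k l, Z (k + l) ≤ Z k * Z l) (k₀ r : ℕ) :
    ∀ q : ℕ, Z (q * k₀ + r) ≤ Z k₀ ^ q * Z r := by
  intro q
  induction q with
  | zero => simp
  | succ q ih =>
    have h1 : (q + 1) * k₀ + r = k₀ + (q * k₀ + r) := by ring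
    rw [h1]
    calc Z (k₀ + (q * k₀ + r)) ≤ Z k₀ * Z (q * k₀ + r) := hsub _ _
      _ ≤ Z k₀ * (Z k₀ ^ q * Z r) := mul_le_mul_of_nonneg_left ih (hZ0 _)
      _ = Z k₀ ^ (q + 1) * Z r := by ring

/-- Eventual geometric decay: if `0 ≤ ρ < 1` and `0 ≤ B` then `ρ^q · B ≤ 1` for all large `q`. -/
theorem fekete_eventually_pow_mul_le_one (ρ B : ℝ) (hρ0 : 0 ≤ ρ) (hρ1 : ρ < 1) (hB : 0 ≤ B) :
    ∃ q₀ : ℕ, ∀ q ≥ q₀, ρ ^ q * B ≤ 1 := by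
  rcases eq_or_lt_of_le hB with hB0 | hBpos
  · exact ⟨0, fun q _ => by rw [← hB0, mul_zero]; exact zero_le_one⟩
  · obtain ⟨n, hn⟩ := exists_pow_lt_of_lt_one (by positivity : 0 < 1 / B) hρ1
    refine ⟨n, fun q hq => ?_⟩
    have h1 : ρ ^ q ≤ ρ ^ n := pow_le_pow_of_le_one hρ0 hρ1.le hq
    have h2 : ρ ^ q < 1 / B := h1.trans_lt hn
    rw [lt_div_iff₀ hBpos] at h2
    exact h2.le

/-- **Fekete's lemma, weak form.** A nonnegative submultiplicative sequence `Z` with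
`Z k₀ < P ^ k₀` at a single scale `k₀ ≥ 1` (and `P > 0`) satisfies `Z k ≤ P ^ k` for all
sufficiently large `k`. -/
theorem stub_fekete :
    ∀ (Z : ℕ → ℝ) (P : ℝ), 0 < P → (∀ k, 0 ≤ Z k) → (∀ k l, Z (k + l) ≤ Z k * Z l) →
      ∀ k₀ : ℕ, 1 ≤ k₀ → Z k₀ < P ^ k₀ → ∃ K : ℕ, ∀ k ≥ K, Z k ≤ P ^ k := by
  intro Z P hP hZ0 hsub k₀ hk₀ hlt
  -- the ratio `ρ ∈ [0, 1)` and the bound `B` on the prefix ratios `Z r / P ^ r`, `r < k₀`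
  set ρ : ℝ := Z k₀ / P ^ k₀ with hρ_def
  have hPk0 : 0 < P ^ k₀ := pow_pos hP k₀
  have hρ0 : 0 ≤ ρ := div_nonneg (hZ0 _) hPk0.le
  have hρ1 : ρ < 1 := (div_lt_one hPk0).2 hlt
  set B : ℝ := ∑ r ∈ Finset.range k₀, Z r / P ^ r with hB_def
  have hB0 : 0 ≤ B := Finset.sum_nonneg fun r _ => div_nonneg (hZ0 r) (pow_pos hP r).le
  have hBr : ∀ r < k₀, Z r / P ^ r ≤ B := fun r hr =>
    Finset.single_le_sum (f := fun r => Z r / P ^ r)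
      (fun r _ => div_nonneg (hZ0 r) (pow_pos hP r).le) (Finset.mem_range.2 hr)
  -- main estimate: `Z (q k₀ + r) ≤ ρ^q · B · P^(q k₀ + r)` for `r < k₀`
  have hmain : ∀ q r, r < k₀ → Z (q * k₀ + r) ≤ ρ ^ q * B * P ^ (q * k₀ + r) := by
    intro q r hr
    have hPr : 0 < P ^ r := pow_pos hP r
    have h1 : Z (q * k₀ + r) ≤ Z k₀ ^ q * Z r := fekete_submul_iter Z hZ0 hsub k₀ r q
    have h2 : ρ * P ^ k₀ = Z k₀ := by rw [hρ_def, div_mul_cancel₀ _ hPk0.ne']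
    have h3 : Z r / P ^ r * P ^ r = Z r := by rw [div_mul_cancel₀ _ hPr.ne']
    have h4 : Z r / P ^ r * P ^ r ≤ B * P ^ r :=
      mul_le_mul_of_nonneg_right (hBr r hr) hPr.le
    calc Z (q * k₀ + r) ≤ Z k₀ ^ q * Z r := h1
      _ = (ρ * P ^ k₀) ^ q * (Z r / P ^ r * P ^ r) := by rw [h2, h3]
      _ ≤ (ρ * P ^ k₀) ^ q * (B * P ^ r) :=
          mul_le_mul_of_nonneg_left h4 (pow_nonneg (mul_nonneg hρ0 hPk0.le) q)
      _ = ρ ^ q * B * P ^ (q * k₀ + r) := by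
          rw [mul_pow, ← pow_mul, pow_add, mul_comm k₀ q]; ring
  -- choose `q₀` with `ρ^q · B ≤ 1` for `q ≥ q₀`, and take `K = q₀ k₀`
  obtain ⟨q₀, hq₀⟩ := fekete_eventually_pow_mul_le_one ρ B hρ0 hρ1 hB0
  refine ⟨q₀ * k₀, fun k hk => ?_⟩
  have hk0pos : 0 < k₀ := hk₀
  have hdecomp : k / k₀ * k₀ + k % k₀ = k := Nat.div_add_mod' k k₀
  have hr : k % k₀ < k₀ := Nat.mod_lt k hk0pos
  have hq : q₀ ≤ k / k₀ := (Nat.le_div_iff_mul_le hk0pos).2 hk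
  have h1 := hmain (k / k₀) (k % k₀) hr
  rw [hdecomp] at h1
  have h2 : ρ ^ (k / k₀) * B ≤ 1 := hq₀ _ hq
  calc Z k ≤ ρ ^ (k / k₀) * B * P ^ k := h1
    _ ≤ 1 * P ^ k := mul_le_mul_of_nonneg_right h2 (pow_pos hP k).le
    _ = P ^ k := one_mul _

end Summit.MatrixMultiplication.MatrixMultiplication.Theorems.RegularTowerGap
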